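import Mathlib
import HarnessLib
import Summits.ValiantsHypothesis.ValiantsHypothesis.Theorems.KPlusLogSqLawMixedGaugeCoordBlockFamily

/-!
# Route «KPlusLogSqLaw», `WeakLifting` (stmt-ValiantsHypothesis-19561) — mixed-gauge series, several fast speeds: THE DOUBLY-DIAGONAL VERTEX-GAUGE
# BLOCK FAMILY `x ↦ [[A + diag(x^{aᵢ}), B], [Bᵀ, C − diag(x^{b_l})]]` — two-point identity, first-order form, end scales

HONEST FRAMING.  Helper file (hand leafhand-val-kpluslogsqlaw-1 g14, 2026-08-31; `--supports stmt-ValiantsHypothesis-19561 --as helper`,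
zero crux / stub credit).  The doubly-diagonal analogue of `…MixedGaugeCoordBlockFamily` (p835032): `n` slow positive diagonal monomials of
individual speeds `aᵢ ≥ 1`, `m` fast NEGATIVE diagonal monomials of individual speeds `b_l ≥ 1`, one constant symmetric letter.  Content: the
two-point identity `Σᵢ (Dᵢ' − Dᵢ) wᵢwᵢ' = Σ_l (E_l' − E_l) q_lq_l'` (`biCoord_two_point_blocks`); symmetry / continuity; the first-order form with
geometric-sum diagonal blocks on both sides; the kernel form `Σᵢ αᵢwᵢ² − Σ_l β_l q_l²` (`form_biCoordDiagBlocks`); the END SCALES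
(`biCoordFamily_det_ne_zero_of_large`, `biCoordFamily_negIndex_ge_of_large`).  Feeds the several-fast-speeds law (sequel, with the two-scale
family downward law p835170).  Nothing here is about `WeakLifting` / `TropicalB` in their windows, the registered stubs, the doors,
`MatrixDescartes` (18050) or VP ≠ VNP.  No `def`; axioms standard. [folklore]
-/

set_option linter.dupNamespace false
set_option autoImplicit false

namespace Summit.ValiantsHypothesis.ValiantsHypothesis.Theorems.KPlusLogSqLaw

namespace MixedGauge

open Matrix Finset Polynomial
open scoped BigOperators Topology
open Summit.ValiantsHypothesis.ValiantsHypothesis.Theorems.LacunarySymmetroidMatrixDescartes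
open Summit.ValiantsHypothesis.ValiantsHypothesis.Theorems.LacunarySymmetroidMatrixDescartes.Inertia

variable {n m : ℕ}

/-! ## 1. Two-point identity and kernel form -/

/-- **Doubly-diagonal block two-point identity.** [folklore] -/
theorem biCoord_two_point_blocks (A : Matrix (Fin n) (Fin n) ℝ) (hA : A.IsSymm) (C : Matrix (Fin m) (Fin m) ℝ) (hC : C.IsSymm)
    (B : Matrix (Fin n) (Fin m) ℝ) (D D' : Fin n → ℝ) (E E' : Fin m → ℝ) (w w' : Fin n → ℝ) (q q' : Fin m → ℝ)
    (h1 : (A + Matrix.diagonal D) *ᵥ w + B *ᵥ q = 0)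
    (h2 : Bᵀ *ᵥ w + (C - Matrix.diagonal E) *ᵥ q = 0)
    (h1' : (A + Matrix.diagonal D') *ᵥ w' + B *ᵥ q' = 0)
    (h2' : Bᵀ *ᵥ w' + (C - Matrix.diagonal E') *ᵥ q' = 0) :
    ∑ i, (D' i - D i) * (w i * w' i) = ∑ l, (E' l - E l) * (q l * q' l) := by
  have e1 : w' ⬝ᵥ ((A + Matrix.diagonal D) *ᵥ w + B *ᵥ q) = 0 := by rw [h1, dotProduct_zero]
  have e1' : w ⬝ᵥ ((A + Matrix.diagonal D') *ᵥ w' + B *ᵥ q') = 0 := by rw [h1', dotProduct_zero]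
  have e2 : q' ⬝ᵥ (Bᵀ *ᵥ w + (C - Matrix.diagonal E) *ᵥ q) = 0 := by rw [h2, dotProduct_zero]
  have e2' : q ⬝ᵥ (Bᵀ *ᵥ w' + (C - Matrix.diagonal E') *ᵥ q') = 0 := by rw [h2', dotProduct_zero]
  have hAs : w' ⬝ᵥ (A *ᵥ w) = w ⬝ᵥ (A *ᵥ w') := by
    rw [Matrix.dotProduct_mulVec, ← Matrix.mulVec_transpose, hA, dotProduct_comm]
  have hCs : q' ⬝ᵥ (C *ᵥ q) = q ⬝ᵥ (C *ᵥ q') := by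
    rw [Matrix.dotProduct_mulVec, ← Matrix.mulVec_transpose, hC, dotProduct_comm]
  have hB1 : w' ⬝ᵥ (B *ᵥ q) = q ⬝ᵥ (Bᵀ *ᵥ w') := by
    rw [Matrix.dotProduct_mulVec, ← Matrix.mulVec_transpose, dotProduct_comm]
  have hB2 : w ⬝ᵥ (B *ᵥ q') = q' ⬝ᵥ (Bᵀ *ᵥ w) := by
    rw [Matrix.dotProduct_mulVec, ← Matrix.mulVec_transpose, dotProduct_comm]
  have hD : w' ⬝ᵥ (Matrix.diagonal D *ᵥ w) = ∑ i, D i * (w i * w' i) := by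
    rw [dotProduct]; refine Finset.sum_congr rfl fun i _ => ?_; rw [Matrix.mulVec_diagonal]; ring
  have hD' : w ⬝ᵥ (Matrix.diagonal D' *ᵥ w') = ∑ i, D' i * (w i * w' i) := by
    rw [dotProduct]; refine Finset.sum_congr rfl fun i _ => ?_; rw [Matrix.mulVec_diagonal]; ring
  have hE : q' ⬝ᵥ (Matrix.diagonal E *ᵥ q) = ∑ l, E l * (q l * q' l) := by
    rw [dotProduct]; refine Finset.sum_congr rfl fun l _ => ?_; rw [Matrix.mulVec_diagonal]; ring
  have hE' : q ⬝ᵥ (Matrix.diagonal E' *ᵥ q') = ∑ l, E' l * (q l * q' l) := by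
    rw [dotProduct]; refine Finset.sum_congr rfl fun l _ => ?_; rw [Matrix.mulVec_diagonal]; ring
  rw [Matrix.add_mulVec, dotProduct_add, dotProduct_add] at e1 e1'
  rw [Matrix.sub_mulVec, dotProduct_add, dotProduct_sub] at e2 e2'
  rw [hAs, hB1, hD] at e1
  rw [hB2, hD'] at e1'
  rw [hCs, hE] at e2
  rw [hE'] at e2'
  have hsumD : ∑ i, (D' i - D i) * (w i * w' i) = ∑ i, D' i * (w i * w' i) - ∑ i, D i * (w i * w' i) := by
    rw [← Finset.sum_sub_distrib]; refine Finset.sum_congr rfl fun i _ => ?_; ring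
  have hsumE : ∑ l, (E' l - E l) * (q l * q' l) = ∑ l, E' l * (q l * q' l) - ∑ l, E l * (q l * q' l) := by
    rw [← Finset.sum_sub_distrib]; refine Finset.sum_congr rfl fun l _ => ?_; ring
  rw [hsumD, hsumE]
  linear_combination e1' - e1 - e2 + e2'

/-- the form of `[[diag α, 0], [0, −diag β]]` on `(w, q)`. [folklore] -/
theorem form_biCoordDiagBlocks (α : Fin n → ℝ) (β : Fin m → ℝ) (w : Fin n → ℝ) (q : Fin m → ℝ) :
    Sum.elim w q ⬝ᵥ (Matrix.fromBlocks (Matrix.diagonal α) 0 0 (-(Matrix.diagonal β)) *ᵥ Sum.elim w q)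
      = ∑ i, α i * w i ^ 2 - ∑ l, β l * q l ^ 2 := by
  rw [Matrix.fromBlocks_mulVec, Sum.elim_comp_inl, Sum.elim_comp_inr, Matrix.zero_mulVec, Matrix.zero_mulVec, add_zero,
    zero_add, Matrix.neg_mulVec, sumElim_dotProduct_sumElim, dotProduct_neg]
  have hw : w ⬝ᵥ (Matrix.diagonal α *ᵥ w) = ∑ i, α i * w i ^ 2 := by
    rw [dotProduct]; refine Finset.sum_congr rfl fun i _ => ?_; rw [Matrix.mulVec_diagonal]; ring
  have hq : q ⬝ᵥ (Matrix.diagonal β *ᵥ q) = ∑ l, β l * q l ^ 2 := by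
    rw [dotProduct]; refine Finset.sum_congr rfl fun l _ => ?_; rw [Matrix.mulVec_diagonal]; ring
  rw [hw, hq]; ring

/-! ## 2. The family -/

section Family

variable (A : Matrix (Fin n) (Fin n) ℝ) (C : Matrix (Fin m) (Fin m) ℝ) (B : Matrix (Fin n) (Fin m) ℝ) (a : Fin n → ℕ) (bv : Fin m → ℕ)

/-- symmetry. [folklore] -/
theorem biCoordFamily_isSymm (hA : A.IsSymm) (hC : C.IsSymm) (x : ℝ) :
    (Matrix.fromBlocks (A + Matrix.diagonal (fun i => x ^ a i)) B Bᵀ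
      (C - Matrix.diagonal (fun l => x ^ bv l))).IsSymm :=
  Matrix.IsSymm.fromBlocks (hA.add (Matrix.isSymm_diagonal _)) rfl (hC.sub (Matrix.isSymm_diagonal _))

/-- entrywise continuity. [folklore] -/
theorem biCoordFamily_continuous (i j : Fin n ⊕ Fin m) :
    Continuous fun x : ℝ => (Matrix.fromBlocks (A + Matrix.diagonal (fun i => x ^ a i)) B Bᵀ
      (C - Matrix.diagonal (fun l => x ^ bv l))) i j := by
  rcases i with i | i <;> rcases j with j | j
  · simp only [Matrix.fromBlocks_apply₁₁, Matrix.add_apply]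
    by_cases hij : i = j
    · subst hij; simp only [Matrix.diagonal_apply_eq]; fun_prop
    · simp only [Matrix.diagonal_apply_ne _ hij, add_zero]; fun_prop
  · simp only [Matrix.fromBlocks_apply₁₂]
    fun_prop
  · simp only [Matrix.fromBlocks_apply₂₁]
    fun_prop
  · simp only [Matrix.fromBlocks_apply₂₂, Matrix.sub_apply]
    by_cases hij : i = j
    · subst hij; simp only [Matrix.diagonal_apply_eq]; fun_prop
    · simp only [Matrix.diagonal_apply_ne _ hij, sub_zero]; fun_prop

/-- entrywise continuity of the difference-quotient family. [folklore] -/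
theorem biCoordDiffFamily_continuous (t : ℝ) (i j : Fin n ⊕ Fin m) :
    Continuous fun x : ℝ => (Matrix.fromBlocks (Matrix.diagonal (fun i => ∑ l ∈ range (a i), x ^ l * t ^ (a i - 1 - l))) 0 0
      (-(Matrix.diagonal (fun l' => ∑ l ∈ range (bv l'), x ^ l * t ^ (bv l' - 1 - l))))) i j := by
  rcases i with i | i <;> rcases j with j | j
  · simp only [Matrix.fromBlocks_apply₁₁]
    by_cases hij : i = j
    · subst hij; simp only [Matrix.diagonal_apply_eq]; fun_prop
    · simp only [Matrix.diagonal_apply_ne _ hij]; fun_prop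
  · simp only [Matrix.fromBlocks_apply₁₂, Matrix.zero_apply]
    fun_prop
  · simp only [Matrix.fromBlocks_apply₂₁, Matrix.zero_apply]
    fun_prop
  · simp only [Matrix.fromBlocks_apply₂₂, Matrix.neg_apply]
    by_cases hij : i = j
    · subst hij; simp only [Matrix.diagonal_apply_eq]; fun_prop
    · simp only [Matrix.diagonal_apply_ne _ hij]; fun_prop

/-- the first-order form at `t`. [folklore] -/
theorem biCoordFamily_firstOrder (t x : ℝ) :
    Matrix.fromBlocks (A + Matrix.diagonal (fun i => x ^ a i)) B Bᵀ (C - Matrix.diagonal (fun l => x ^ bv l))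
      = Matrix.fromBlocks (A + Matrix.diagonal (fun i => t ^ a i)) B Bᵀ (C - Matrix.diagonal (fun l => t ^ bv l))
        + (x - t) • Matrix.fromBlocks (Matrix.diagonal (fun i => ∑ l ∈ range (a i), x ^ l * t ^ (a i - 1 - l))) 0 0
            (-(Matrix.diagonal (fun l' => ∑ l ∈ range (bv l'), x ^ l * t ^ (bv l' - 1 - l)))) := by
  have hga : ∀ i, x ^ a i = t ^ a i + (x - t) * ∑ l ∈ range (a i), x ^ l * t ^ (a i - 1 - l) := by
    intro i
    have := (Commute.all x t).geom_sum₂_mul (a i)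
    linear_combination -this
  have hgb : ∀ l', x ^ bv l' = t ^ bv l' + (x - t) * ∑ l ∈ range (bv l'), x ^ l * t ^ (bv l' - 1 - l) := by
    intro l'
    have := (Commute.all x t).geom_sum₂_mul (bv l')
    linear_combination -this
  rw [Matrix.fromBlocks_smul, Matrix.fromBlocks_add, smul_zero, smul_zero, add_zero, add_zero]
  congr 1
  · rw [add_assoc, ← Matrix.diagonal_smul, Matrix.diagonal_add]
    congr 1
    congr 1
    funext i
    rw [hga i, Pi.smul_apply, smul_eq_mul]
  · rw [smul_neg, ← Matrix.diagonal_smul, ← sub_eq_add_neg, sub_sub, Matrix.diagonal_add]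
    congr 2
    funext l'
    rw [hgb l', Pi.smul_apply, smul_eq_mul]

/-! ## 3. End scales -/

/-- non-singular at a large scale. [folklore] -/
theorem biCoordFamily_det_ne_zero_of_large (ha : ∀ i, 1 ≤ a i) (hb : ∀ l, 1 ≤ bv l) (x : ℝ) (hx1 : 1 ≤ x)
    (hxA : ∑ i, ∑ j, |A i j| < x) (hxC : ∑ i, ∑ j, |C i j| < x) :
    (Matrix.fromBlocks (A + Matrix.diagonal (fun i => x ^ a i)) B Bᵀ
      (C - Matrix.diagonal (fun l => x ^ bv l))).det ≠ 0 := by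
  intro hdet
  obtain ⟨u, hu0, hu⟩ := Matrix.exists_mulVec_eq_zero_iff.mpr hdet
  set w : Fin n → ℝ := u ∘ Sum.inl with hw
  set q : Fin m → ℝ := u ∘ Sum.inr with hq
  have huwq : u = Sum.elim w q := by
    funext i; rcases i with i | i <;> rfl
  rw [huwq, Matrix.fromBlocks_mulVec] at hu
  have h1 : (A + Matrix.diagonal (fun i => x ^ a i)) *ᵥ w + B *ᵥ q = 0 := by
    funext i; have := congrFun hu (Sum.inl i); simpa using this
  have h2 : Bᵀ *ᵥ w + (C - Matrix.diagonal (fun l => x ^ bv l)) *ᵥ q = 0 := by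
    funext i; have := congrFun hu (Sum.inr i); simpa using this
  have e1 : w ⬝ᵥ ((A + Matrix.diagonal (fun i => x ^ a i)) *ᵥ w) + w ⬝ᵥ (B *ᵥ q) = 0 := by
    rw [← dotProduct_add, h1, dotProduct_zero]
  have e2 : q ⬝ᵥ (Bᵀ *ᵥ w) + q ⬝ᵥ ((C - Matrix.diagonal (fun l => x ^ bv l)) *ᵥ q) = 0 := by
    rw [← dotProduct_add, h2, dotProduct_zero]
  have e3 : q ⬝ᵥ (Bᵀ *ᵥ w) = w ⬝ᵥ (B *ᵥ q) := by
    rw [Matrix.dotProduct_mulVec, Matrix.vecMul_transpose, dotProduct_comm]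
  have hAw : w ⬝ᵥ ((A + Matrix.diagonal (fun i => x ^ a i)) *ᵥ w) = w ⬝ᵥ (A *ᵥ w) + ∑ i, x ^ a i * w i ^ 2 := by
    rw [Matrix.add_mulVec, dotProduct_add]
    congr 1
    rw [dotProduct]; refine Finset.sum_congr rfl fun i _ => ?_; rw [Matrix.mulVec_diagonal]; ring
  have hCq : q ⬝ᵥ ((C - Matrix.diagonal (fun l => x ^ bv l)) *ᵥ q) = q ⬝ᵥ (C *ᵥ q) - ∑ l, x ^ bv l * q l ^ 2 := by
    rw [Matrix.sub_mulVec, dotProduct_sub]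
    congr 1
    rw [dotProduct]; refine Finset.sum_congr rfl fun l _ => ?_; rw [Matrix.mulVec_diagonal]; ring
  have hbA' := form_le_absSum_mul (-A) w
  have hbC := form_le_absSum_mul C q
  have hnegA : ∑ i, ∑ j, |(-A) i j| = ∑ i, ∑ j, |A i j| := by simp
  rw [hnegA, Matrix.neg_mulVec, dotProduct_neg] at hbA'
  have hww : 0 ≤ w ⬝ᵥ w := by rw [dotProduct]; exact Finset.sum_nonneg fun i _ => mul_self_nonneg _
  have hqq : 0 ≤ q ⬝ᵥ q := by rw [dotProduct]; exact Finset.sum_nonneg fun i _ => mul_self_nonneg _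
  have hdiagA : x * (w ⬝ᵥ w) ≤ ∑ i, x ^ a i * w i ^ 2 := by
    rw [dotProduct, Finset.mul_sum]
    refine Finset.sum_le_sum fun i _ => ?_
    have hxa : x ≤ x ^ a i := le_self_pow₀ hx1 (by have := ha i; omega)
    nlinarith [mul_self_nonneg (w i)]
  have hdiagC : x * (q ⬝ᵥ q) ≤ ∑ l, x ^ bv l * q l ^ 2 := by
    rw [dotProduct, Finset.mul_sum]
    refine Finset.sum_le_sum fun l _ => ?_
    have hxb : x ≤ x ^ bv l := le_self_pow₀ hx1 (by have := hb l; omega)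
    nlinarith [mul_self_nonneg (q l)]
  have hsum : (w ⬝ᵥ (A *ᵥ w) + ∑ i, x ^ a i * w i ^ 2) + ((∑ l, x ^ bv l * q l ^ 2) - q ⬝ᵥ (C *ᵥ q)) = 0 := by
    rw [hAw] at e1; rw [hCq, e3] at e2; linarith
  have hcA : 0 < x - ∑ i, ∑ j, |A i j| := by linarith
  have hcC : 0 < x - ∑ i, ∑ j, |C i j| := by linarith
  have hp1 : 0 ≤ w ⬝ᵥ (A *ᵥ w) + ∑ i, x ^ a i * w i ^ 2 := by nlinarith [mul_nonneg hcA.le hww]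
  have hp2 : 0 ≤ (∑ l, x ^ bv l * q l ^ 2) - q ⬝ᵥ (C *ᵥ q) := by nlinarith [mul_nonneg hcC.le hqq]
  have hz1 : w ⬝ᵥ (A *ᵥ w) + ∑ i, x ^ a i * w i ^ 2 = 0 := by linarith
  have hz2 : (∑ l, x ^ bv l * q l ^ 2) - q ⬝ᵥ (C *ᵥ q) = 0 := by linarith
  have hw0 : w ⬝ᵥ w = 0 := by
    by_contra hne
    have hpos : 0 < w ⬝ᵥ w := lt_of_le_of_ne hww (Ne.symm hne)
    nlinarith [mul_pos hcA hpos]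
  have hq0 : q ⬝ᵥ q = 0 := by
    by_contra hne
    have hpos : 0 < q ⬝ᵥ q := lt_of_le_of_ne hqq (Ne.symm hne)
    nlinarith [mul_pos hcC hpos]
  apply hu0
  rw [huwq, dotProduct_self_eq_zero.mp hw0, dotProduct_self_eq_zero.mp hq0]
  funext i; rcases i with i | i <;> rfl

/-- at a large scale the fast block is negative definite: `ν ≥ m`. [folklore] -/
theorem biCoordFamily_negIndex_ge_of_large (hA : A.IsSymm) (hC : C.IsSymm) (hb : ∀ l, 1 ≤ bv l) (x : ℝ) (hx1 : 1 ≤ x)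
    (hxC : ∑ i, ∑ j, |C i j| < x) :
    m ≤ Fintype.card {j // (isHermitian_of_isSymm (biCoordFamily_isSymm A C B a bv hA hC x)).eigenvalues j < 0} := by
  have h := card_le_negIndex (isHermitian_of_isSymm (biCoordFamily_isSymm A C B a bv hA hC x))
    (fun i : Fin m => Sum.elim (0 : Fin n → ℝ) (Pi.single i (1 : ℝ) : Fin m → ℝ)) ?_
  · simpa using h
  intro c hc
  have hcomb : (∑ i, c i • Sum.elim (0 : Fin n → ℝ) (Pi.single i (1 : ℝ) : Fin m → ℝ)) = Sum.elim (0 : Fin n → ℝ) c := by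
    funext l
    rcases l with l | l
    · simp [Finset.sum_apply]
    · simp [Finset.sum_apply, Pi.single_apply]
  rw [hcomb, Matrix.fromBlocks_mulVec, Sum.elim_comp_inl, Sum.elim_comp_inr, Matrix.mulVec_zero, Matrix.mulVec_zero,
    zero_add, zero_add, sumElim_dotProduct_sumElim, zero_dotProduct, zero_add, Matrix.sub_mulVec, dotProduct_sub]
  have hdiag : c ⬝ᵥ (Matrix.diagonal (fun l => x ^ bv l) *ᵥ c) = ∑ l, x ^ bv l * c l ^ 2 := by
    rw [dotProduct]; refine Finset.sum_congr rfl fun l _ => ?_; rw [Matrix.mulVec_diagonal]; ring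
  rw [hdiag]
  have hbC := form_le_absSum_mul C c
  have hcc : 0 < c ⬝ᵥ c := by
    rw [dotProduct]
    obtain ⟨i, hi⟩ : ∃ i, c i ≠ 0 := by
      by_contra h; push Not at h; exact hc (funext h)
    exact lt_of_lt_of_le (mul_self_pos.mpr hi) (Finset.single_le_sum (f := fun l => c l * c l)
      (fun l _ => mul_self_nonneg _) (Finset.mem_univ i))
  have hdiagC : x * (c ⬝ᵥ c) ≤ ∑ l, x ^ bv l * c l ^ 2 := by
    rw [dotProduct, Finset.mul_sum]
    refine Finset.sum_le_sum fun l _ => ?_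
    have hxb : x ≤ x ^ bv l := le_self_pow₀ hx1 (by have := hb l; omega)
    nlinarith [mul_self_nonneg (c l)]
  have hcoef : 0 < x - ∑ i, ∑ j, |C i j| := by linarith
  nlinarith [mul_pos hcoef hcc]

end Family

end MixedGauge

end Summit.ValiantsHypothesis.ValiantsHypothesis.Theorems.KPlusLogSqLaw
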